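import Summits.AtomisticToContinuum.Crystallization.Theorems.PalmUnimodularRigidityMinimiserShellsPeriodicShellGapOfQualShellNoBoundary

/-!
# Blocks of a hard-core periodic configuration with many loosely-bad sites (stub `stub_necessity_blocks`, N3)

Stub `stub_necessity_blocks` (N3, necessity sandwich) of line `equilibrium-in-law-surgery` (reshape r6)
of crux `MinimiserShells` (stmt-AtomisticToContinuum-9225, route `PalmUnimodularRigidity`).

Statement.  Let `θ ≥ 0`, let `Q` be a periodic configuration of `ℝ³` whose point set `Q.points` is
`1/3`-separated, and suppose at least `t · #F` motif sites `x ∈ F` are LOOSELY badly shelled in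
`Q.points`: the loose good-shell predicate of a measure `μ` on `ℝ³` is
`∃ a ∈ [9/10, 1], ∃ T, ↑T = {w | μ {w} ≠ 0, w ≠ 0, ‖w‖ ≤ (5/4 − θ)·a} ∧ T is (a/100 + θ)-close to a·FCC or a·HCP`,
evaluated at the re-rooted counting measure `count|((· − x) '' Q.points)`.  Then for every `ε > 0`
there is a finite injective `1/3`-separated configuration `y : Fin N → ℝ³`, `N > 0`, with
`𝓔_N(y) ≤ N · (e(Q) + ε)` and at least `(t − ε) · N` indices `i` loosely badly shelled in `y`
(re-rooted counting measure `count|((· − y i) '' range y)`).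

Proof (blocks, after S14 `PeriodicShellGapConverse.stub_periodicShellGap_of_qualShellNoBoundary`).
Everything is proved for an arbitrary shell predicate `G : Measure ℝ³ → Prop` that is LOCAL — two
measures with the same atoms in the closed ball `B̄(0, 5/4)` get the same verdict — and then
instantiated at the loose predicate, which is local for `θ ≥ 0` since it reads only atoms of norm
`≤ (5/4 − θ)·a ≤ 5/4` (`looseGood_congr_of_local`).  The configuration is the `K³`-block
`blockConfig Q K : Fin (#F·K³) → ℝ³` of `Q` (`ChargedEnergyGapNegative.Blocks`): it is injective
(`blockConfig_injective`), its points are points of `Q` (`LayeredLawsSelectHcp.range_blockConfig_subset`)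
so it inherits the separation, and its energy is `≤ #F·K³·(e(Q) + ε)` for `K ≥ K₀(ε)`
(`Blocks.exists_block_energy_le`).  A block point over the motif site `x` with `depth Q 2`-deep lattice
coordinates sees within distance `3/2` only block points
(`PeriodicShellGapConverse.points_inter_closedBall_subset_range`) and sees the re-rooted point set of `x`
(lattice invariance, `PeriodicShellGapConverse.image_sub_bpt_points`), so by locality it is badly shelled
in the block iff `x` is badly shelled in `Q.points` (`block_iff`); hence
`#bad(block) ≥ #deep · #bad(F) ≥ (K³ − 6·depth·K²) · t · #F` (`card_bad_block_ge`, `Blocks.card_deep_ge`),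
which is `≥ (t − ε) · #F·K³` as soon as `6·depth·t ≤ ε·K` (the case `t ≤ ε` being trivial).
-/

noncomputable section

open MeasureTheory
open scoped ENNReal BigOperators Classical

namespace Summit.AtomisticToContinuum.Crystallization.Theorems.PalmUnimodularRigidityMinimiserShells.NecessityBlocks

open Literature.MathematicalPhysics.StatisticalMechanics (lennardJones interactionEnergy PeriodicConfiguration)
open Literature.Geometry.DiscreteGeometry (ShellCloseTo fccKissingPattern hcpKissingPattern)
open Summit.AtomisticToContinuum.Crystallization.Theorems.MinimiserShells.Negative.Rootedness (E3)
open Summit.AtomisticToContinuum.Crystallization.Theorems.PalmUnimodularRigidityMinimiserShells.ShellNoBoundary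
  (count_restrict_image_sub_singleton_ne_zero_iff)
open Summit.AtomisticToContinuum.Crystallization.Theorems.ChargedEnergyGapNegative.Blocks
  (BIdx bpt card_BIdx blockConfig blockConfig_apply blockConfig_injective IsDeep depth
   exists_block_energy_le card_deep_ge)
open Summit.AtomisticToContinuum.Crystallization.Theorems.PalmUnimodularRigidity.LayeredLawsSelectHcp
  (range_blockConfig_subset)
open Summit.AtomisticToContinuum.Crystallization.Theorems.PalmUnimodularRigidityMinimiserShells.PeriodicShellGapConverse
  (image_sub_bpt_points points_inter_closedBall_subset_range)

/-! ## Local shell predicates -/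

/-- **Deep sites see the same local verdict in `S` and in the window.**  Let `G` be a LOCAL predicate of
measures on `ℝ³` (two measures with the same atoms in `B̄(0, 5/4)` get the same verdict).  If `C ⊆ S`
contains every point of `S` within distance `R₀ ≥ 5/4` of `y`, then the re-rooted counting measures
`count|((· - y) '' S)` and `count|((· - y) '' C)` get the same verdict. -/
theorem congr_count_restrict_image_sub_of_local {G : Measure E3 → Prop}
    (hloc : ∀ {μ ν : Measure E3}, (∀ w : E3, ‖w‖ ≤ 5 / 4 → (μ {w} ≠ 0 ↔ ν {w} ≠ 0)) → (G μ ↔ G ν))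
    {S C : Set E3} (hCS : C ⊆ S) {y : E3} {R₀ : ℝ} (hR₀ : 5 / 4 ≤ R₀)
    (hdeep : S ∩ Metric.closedBall y R₀ ⊆ C) :
    G ((Measure.count : Measure E3).restrict ((fun z => z - y) '' S)) ↔
      G ((Measure.count : Measure E3).restrict ((fun z => z - y) '' C)) := by
  refine hloc fun w hw => ?_
  rw [count_restrict_image_sub_singleton_ne_zero_iff, count_restrict_image_sub_singleton_ne_zero_iff]
  refine ⟨fun hS => hdeep ⟨hS, ?_⟩, fun hC => hCS hC⟩
  rw [Metric.mem_closedBall, dist_eq_norm, add_sub_cancel_right]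
  exact hw.trans hR₀

/-! ## Local verdicts at deep block points -/

/-- **Deep block points get the verdict of their motif point.**  For a local predicate `G` and
`depth Q 2`-deep lattice coordinates `k`, the block point `x + latVec (coords k)` re-rooted in the finite
block configuration gets the same verdict as the motif point `x` re-rooted in the infinite point set
`Q.points` (locality with `R₀ = 3/2`, `points_inter_closedBall_subset_range`, and lattice invariance
`image_sub_bpt_points`). -/
theorem block_iff {G : Measure E3 → Prop}
    (hloc : ∀ {μ ν : Measure E3}, (∀ w : E3, ‖w‖ ≤ 5 / 4 → (μ {w} ≠ 0 ↔ ν {w} ≠ 0)) → (G μ ↔ G ν))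
    (Q : PeriodicConfiguration 3) (K : ℕ) (x : Q.motif) {k : Fin 3 → Fin K}
    (hdeep : IsDeep K (depth Q 2) k) :
    G ((Measure.count : Measure E3).restrict
        ((fun z => z - bpt Q K (x, k)) '' Set.range (blockConfig Q K))) ↔
      G ((Measure.count : Measure E3).restrict ((fun z => z - (x : E3)) '' Q.points)) := by
  rw [← image_sub_bpt_points Q K (x, k)]
  exact (congr_count_restrict_image_sub_of_local hloc (range_blockConfig_subset Q K)
    (by norm_num : (5 : ℝ) / 4 ≤ 3 / 2)
    (points_inter_closedBall_subset_range Q K (u := (x, k)) hdeep)).symm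

/-- **Deep coordinates × bad motif sites inject into the bad block indices** (for a local predicate
`G`): `#{k deep} · #{x ∈ F with ¬ G at x in Q.points} ≤ #{a with ¬ G at a in the block}`
(`(k, x) ↦ equivFin (x, k)`, `block_iff`). -/
theorem card_bad_block_ge {G : Measure E3 → Prop}
    (hloc : ∀ {μ ν : Measure E3}, (∀ w : E3, ‖w‖ ≤ 5 / 4 → (μ {w} ≠ 0 ↔ ν {w} ≠ 0)) → (G μ ↔ G ν))
    (Q : PeriodicConfiguration 3) (K : ℕ) :
    Nat.card {k : Fin 3 → Fin K // IsDeep K (depth Q 2) k} *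
        Nat.card {x : Q.motif // ¬ G ((Measure.count : Measure E3).restrict
          ((fun z => z - (x : E3)) '' Q.points))} ≤
      Nat.card {a : Fin (Fintype.card (BIdx Q K)) // ¬ G ((Measure.count : Measure E3).restrict
          ((fun z => z - blockConfig Q K a) '' Set.range (blockConfig Q K)))} := by
  let f : {k : Fin 3 → Fin K // IsDeep K (depth Q 2) k} ×
      {x : Q.motif // ¬ G ((Measure.count : Measure E3).restrict
          ((fun z => z - (x : E3)) '' Q.points))} →
      {a : Fin (Fintype.card (BIdx Q K)) // ¬ G ((Measure.count : Measure E3).restrict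
          ((fun z => z - blockConfig Q K a) '' Set.range (blockConfig Q K)))} :=
    fun p => ⟨Fintype.equivFin (BIdx Q K) (p.2.1, p.1.1), by
      rw [blockConfig_apply, Equiv.symm_apply_apply, block_iff hloc Q K p.2.1 p.1.2]
      exact p.2.2⟩
  have hf : Function.Injective f := by
    rintro ⟨⟨k, _⟩, ⟨x, _⟩⟩ ⟨⟨k', _⟩, ⟨x', _⟩⟩ h
    have h' : Fintype.equivFin (BIdx Q K) (x, k) = Fintype.equivFin (BIdx Q K) (x', k') :=
      congrArg Subtype.val h
    obtain ⟨rfl, rfl⟩ := Prod.ext_iff.1 ((Fintype.equivFin (BIdx Q K)).injective h')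
    rfl
  have := Nat.card_le_card_of_injective f hf
  rwa [Nat.card_prod] at this

/-! ## Blocks with many bad sites -/

/-- **Blocks of a hard-core periodic configuration with many bad motif sites** (for a local predicate
`G`).  If `Q.points` is `1/3`-separated and at least `t · #F` motif sites `x` have `¬ G` at the re-rooted
point set `count|((· - x) '' Q.points)`, then for every `ε > 0` some block `blockConfig Q K` is a finite
injective `1/3`-separated configuration `y : Fin N → ℝ³`, `N = #F·K³ > 0`, with
`𝓔_N(y) ≤ N · (e(Q) + ε)` (`Blocks.exists_block_energy_le`) and at least `(t − ε) · N` indices `i` with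
`¬ G` at `count|((· - y i) '' range y)` (`card_bad_block_ge`, `Blocks.card_deep_ge`, `K` large). -/
theorem exists_blocks {G : Measure E3 → Prop}
    (hloc : ∀ {μ ν : Measure E3}, (∀ w : E3, ‖w‖ ≤ 5 / 4 → (μ {w} ≠ 0 ↔ ν {w} ≠ 0)) → (G μ ↔ G ν))
    (Q : PeriodicConfiguration 3)
    (hsep : ∀ p ∈ Q.points, ∀ q ∈ Q.points, p ≠ q → (1 : ℝ) / 3 ≤ dist p q) (t : ℝ)
    (hbad : t * (Q.motif.card : ℝ) ≤ (Nat.card {x : Q.motif //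
      ¬ G ((Measure.count : Measure E3).restrict ((fun z => z - (x : E3)) '' Q.points))} : ℝ))
    {ε : ℝ} (hε : 0 < ε) :
    ∃ N : ℕ, 0 < N ∧ ∃ y : Fin N → E3, Function.Injective y ∧
      (∀ i j : Fin N, i ≠ j → (1 : ℝ) / 3 ≤ dist (y i) (y j)) ∧
      interactionEnergy lennardJones y ≤ (N : ℝ) * (Q.energyPerParticle lennardJones + ε) ∧
      (t - ε) * (N : ℝ) ≤ (Nat.card {i : Fin N //
        ¬ G ((Measure.count : Measure E3).restrict ((fun z => z - y i) '' Set.range y))} : ℝ) := by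
  have hF : (0 : ℝ) < Q.motif.card := by exact_mod_cast Q.motif_nonempty.card_pos
  -- blocks are trial states with slack `ε` per particle
  obtain ⟨K₀, hK₀, hK⟩ := exists_block_energy_le Q hε
  -- a large `K`: beyond `K₀` and with `6 · depth · t ≤ ε · K`
  obtain ⟨K, hKK₀, hKt⟩ : ∃ K : ℕ, K₀ ≤ K ∧ 6 * (depth Q 2 : ℝ) * t / ε ≤ K :=
    ⟨max K₀ ⌈6 * (depth Q 2 : ℝ) * t / ε⌉₊, le_max_left _ _,
      (Nat.le_ceil _).trans (by exact_mod_cast le_max_right _ _)⟩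
  have hKpos : 0 < K := lt_of_lt_of_le hK₀ hKK₀
  have hKr : (0 : ℝ) < K := by exact_mod_cast hKpos
  have hn : ((Fintype.card (BIdx Q K) : ℕ) : ℝ) = Q.motif.card * (K : ℝ) ^ 3 := by
    exact_mod_cast card_BIdx Q K
  have hN : 0 < Fintype.card (BIdx Q K) := by
    rw [card_BIdx]
    exact mul_pos Q.motif_nonempty.card_pos (pow_pos hKpos 3)
  refine ⟨Fintype.card (BIdx Q K), hN, blockConfig Q K, blockConfig_injective Q K, fun i j hij => ?_,
    hK K hKK₀, ?_⟩
  · -- the separation is inherited from `Q.points`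
    exact hsep _ (range_blockConfig_subset Q K ⟨i, rfl⟩) _ (range_blockConfig_subset Q K ⟨j, rfl⟩)
      fun h => hij (blockConfig_injective Q K h)
  · -- the count of bad block indices
    rw [hn]
    set B := Nat.card {a : Fin (Fintype.card (BIdx Q K)) // ¬ G ((Measure.count : Measure E3).restrict
      ((fun z => z - blockConfig Q K a) '' Set.range (blockConfig Q K)))}
    have hB0 : (0 : ℝ) ≤ B := Nat.cast_nonneg _
    have hFK : (0 : ℝ) < Q.motif.card * (K : ℝ) ^ 3 := mul_pos hF (pow_pos hKr 3)
    by_cases ht : t ≤ ε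
    · -- a nonpositive threshold is trivially met
      calc (t - ε) * (Q.motif.card * (K : ℝ) ^ 3) ≤ 0 * (Q.motif.card * (K : ℝ) ^ 3) :=
            mul_le_mul_of_nonneg_right (by linarith) hFK.le
        _ = 0 := zero_mul _
        _ ≤ (B : ℝ) := hB0
    · push Not at ht
      have ht0 : 0 < t := hε.trans ht
      -- bad block indices: at least `#deep · #bad(F) ≥ (K³ − 6·d·K²) · t · #F`
      have hcnt := card_bad_block_ge hloc Q K
      have hdeep := card_deep_ge K (depth Q 2)
      set d := depth Q 2
      set D := Nat.card {k : Fin 3 → Fin K // IsDeep K d k}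
      set M := Nat.card {x : Q.motif //
        ¬ G ((Measure.count : Measure E3).restrict ((fun z => z - (x : E3)) '' Q.points))}
      have h1 : (K : ℝ) ^ 3 - 6 * (d : ℝ) * (K : ℝ) ^ 2 ≤ (D : ℝ) := by
        have := (Nat.cast_le (α := ℝ)).2 hdeep
        push_cast at this
        linarith
      have h2 : (D : ℝ) * (M : ℝ) ≤ (B : ℝ) := by exact_mod_cast hcnt
      have hD0 : (0 : ℝ) ≤ D := Nat.cast_nonneg _
      have h6 : 6 * (d : ℝ) * t ≤ ε * K := by
        rw [div_le_iff₀ hε] at hKt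
        linarith
      have hFK2 : (0 : ℝ) ≤ Q.motif.card * (K : ℝ) ^ 2 := by positivity
      have h6' := mul_le_mul_of_nonneg_right h6 hFK2
      calc (t - ε) * (Q.motif.card * (K : ℝ) ^ 3)
          = t * Q.motif.card * (K : ℝ) ^ 3 - ε * K * (Q.motif.card * (K : ℝ) ^ 2) := by ring
        _ ≤ t * Q.motif.card * (K : ℝ) ^ 3 - 6 * (d : ℝ) * t * (Q.motif.card * (K : ℝ) ^ 2) := by
            linarith
        _ = ((K : ℝ) ^ 3 - 6 * (d : ℝ) * (K : ℝ) ^ 2) * (t * Q.motif.card) := by ring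
        _ ≤ (D : ℝ) * (t * Q.motif.card) := mul_le_mul_of_nonneg_right h1 (mul_nonneg ht0.le hF.le)
        _ ≤ (D : ℝ) * (M : ℝ) := mul_le_mul_of_nonneg_left hbad hD0
        _ ≤ (B : ℝ) := h2

/-! ## Locality of the loose shell predicate -/

/-- One direction of `looseGood_congr_of_local`: for `θ ≥ 0`, if `μ` and `ν` have the same atoms in the
closed ball `B̄(0, 5/4)`, a loosely good shell of `μ` is a loosely good shell of `ν` (the loose predicate
reads only atoms of norm `≤ (5/4 − θ)·a ≤ 5/4`, as `a ≤ 1`). -/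
theorem looseGood_of_local {θ : ℝ} (hθ : 0 ≤ θ) {μ ν : Measure E3}
    (h : ∀ w : E3, ‖w‖ ≤ 5 / 4 → (μ {w} ≠ 0 ↔ ν {w} ≠ 0))
    (hμ : ∃ a : ℝ, 9 / 10 ≤ a ∧ a ≤ 1 ∧ ∃ T : Finset E3,
      (↑T : Set E3) = {w : E3 | μ {w} ≠ 0 ∧ w ≠ 0 ∧ ‖w‖ ≤ (5 / 4 - θ) * a} ∧
      (ShellCloseTo (a / 100 + θ) T (Finset.image (fun v : E3 => a • v) fccKissingPattern) ∨
        ShellCloseTo (a / 100 + θ) T (Finset.image (fun v : E3 => a • v) hcpKissingPattern))) :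
    ∃ a : ℝ, 9 / 10 ≤ a ∧ a ≤ 1 ∧ ∃ T : Finset E3,
      (↑T : Set E3) = {w : E3 | ν {w} ≠ 0 ∧ w ≠ 0 ∧ ‖w‖ ≤ (5 / 4 - θ) * a} ∧
      (ShellCloseTo (a / 100 + θ) T (Finset.image (fun v : E3 => a • v) fccKissingPattern) ∨
        ShellCloseTo (a / 100 + θ) T (Finset.image (fun v : E3 => a • v) hcpKissingPattern)) := by
  obtain ⟨a, ha₁, ha₂, T, hT, hclose⟩ := hμ
  refine ⟨a, ha₁, ha₂, T, ?_, hclose⟩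
  have hrad : ∀ w : E3, ‖w‖ ≤ (5 / 4 - θ) * a → ‖w‖ ≤ 5 / 4 := fun w hw => by
    nlinarith [mul_nonneg hθ (show (0 : ℝ) ≤ a by linarith)]
  rw [hT]
  ext w
  simp only [Set.mem_setOf_eq]
  constructor
  · rintro ⟨hw, hw0, hle⟩
    exact ⟨(h w (hrad w hle)).1 hw, hw0, hle⟩
  · rintro ⟨hw, hw0, hle⟩
    exact ⟨(h w (hrad w hle)).2 hw, hw0, hle⟩

/-- **Locality of the loose shell predicate.**  For `θ ≥ 0` the loose good-shell predicate
(scale `a ∈ [9/10, 1]`, radius `(5/4 − θ)·a`, tolerance `a/100 + θ`) reads only which points of the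
closed ball `B̄(0, 5/4)` are atoms: if `μ {w} ≠ 0 ↔ ν {w} ≠ 0` for all `‖w‖ ≤ 5/4`, then `μ` is loosely
well shelled iff `ν` is. -/
theorem looseGood_congr_of_local {θ : ℝ} (hθ : 0 ≤ θ) {μ ν : Measure E3}
    (h : ∀ w : E3, ‖w‖ ≤ 5 / 4 → (μ {w} ≠ 0 ↔ ν {w} ≠ 0)) :
    (∃ a : ℝ, 9 / 10 ≤ a ∧ a ≤ 1 ∧ ∃ T : Finset E3,
      (↑T : Set E3) = {w : E3 | μ {w} ≠ 0 ∧ w ≠ 0 ∧ ‖w‖ ≤ (5 / 4 - θ) * a} ∧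
      (ShellCloseTo (a / 100 + θ) T (Finset.image (fun v : E3 => a • v) fccKissingPattern) ∨
        ShellCloseTo (a / 100 + θ) T (Finset.image (fun v : E3 => a • v) hcpKissingPattern))) ↔
    (∃ a : ℝ, 9 / 10 ≤ a ∧ a ≤ 1 ∧ ∃ T : Finset E3,
      (↑T : Set E3) = {w : E3 | ν {w} ≠ 0 ∧ w ≠ 0 ∧ ‖w‖ ≤ (5 / 4 - θ) * a} ∧
      (ShellCloseTo (a / 100 + θ) T (Finset.image (fun v : E3 => a • v) fccKissingPattern) ∨
        ShellCloseTo (a / 100 + θ) T (Finset.image (fun v : E3 => a • v) hcpKissingPattern))) :=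
  ⟨looseGood_of_local hθ h, looseGood_of_local hθ fun w hw => (h w hw).symm⟩

/-! ## The stub -/

/-- **Stub `stub_necessity_blocks` (N3) of line `equilibrium-in-law-surgery`.**  BLOCKS OF A HARD-CORE
PERIODIC CONFIGURATION WITH MANY LOOSELY-BAD SITES: for `θ ≥ 0`, a periodic configuration `Q` of `ℝ³`
with `1/3`-separated point set and at least `t · #F` motif sites loosely badly shelled in `Q.points`,
and `ε > 0`, there is a finite injective `1/3`-separated configuration `y : Fin N → ℝ³`, `N > 0`, with
`𝓔_N(y) ≤ N · (e(Q) + ε)` and at least `(t − ε) · N` indices loosely badly shelled in `y` — the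
`K³`-block of `Q` for `K` large (`exists_blocks` at the loose predicate, which is local by
`looseGood_congr_of_local`). -/
theorem stub_necessity_blocks :
    ∀ θ : ℝ, 0 ≤ θ → ∀ Q : Literature.MathematicalPhysics.StatisticalMechanics.PeriodicConfiguration 3,
      (∀ p ∈ Q.points, ∀ q ∈ Q.points, p ≠ q → (1 : ℝ) / 3 ≤ dist p q) →
      ∀ t : ℝ, t * (Q.motif.card : ℝ) ≤ (Nat.card {x : Q.motif // ¬ (∃ a : ℝ, 9 / 10 ≤ a ∧ a ≤ 1 ∧ ∃ T : Finset (EuclideanSpace ℝ (Fin 3)),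
            (↑T : Set (EuclideanSpace ℝ (Fin 3))) = {w : EuclideanSpace ℝ (Fin 3) | ((Measure.count : Measure (EuclideanSpace ℝ (Fin 3))).restrict ((fun z => z - (x : EuclideanSpace ℝ (Fin 3))) '' Q.points)) {w} ≠ 0 ∧ w ≠ 0 ∧ ‖w‖ ≤ (5 / 4 - θ) * a} ∧
            (Literature.Geometry.DiscreteGeometry.ShellCloseTo (a / 100 + θ) T
              (Finset.image (fun v : EuclideanSpace ℝ (Fin 3) => a • v) Literature.Geometry.DiscreteGeometry.fccKissingPattern) ∨
             Literature.Geometry.DiscreteGeometry.ShellCloseTo (a / 100 + θ) T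
              (Finset.image (fun v : EuclideanSpace ℝ (Fin 3) => a • v) Literature.Geometry.DiscreteGeometry.hcpKissingPattern)))} : ℝ) →
      ∀ ε : ℝ, 0 < ε → ∃ N : ℕ, 0 < N ∧ ∃ y : Fin N → EuclideanSpace ℝ (Fin 3), Function.Injective y ∧
        (∀ i j : Fin N, i ≠ j → (1 : ℝ) / 3 ≤ dist (y i) (y j)) ∧
        interactionEnergy lennardJones y ≤ (N : ℝ) * (Q.energyPerParticle lennardJones + ε) ∧
        (t - ε) * (N : ℝ) ≤ (Nat.card {i : Fin N // ¬ (∃ a : ℝ, 9 / 10 ≤ a ∧ a ≤ 1 ∧ ∃ T : Finset (EuclideanSpace ℝ (Fin 3)),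
            (↑T : Set (EuclideanSpace ℝ (Fin 3))) = {w : EuclideanSpace ℝ (Fin 3) | ((Measure.count : Measure (EuclideanSpace ℝ (Fin 3))).restrict ((fun z => z - y i) '' Set.range y)) {w} ≠ 0 ∧ w ≠ 0 ∧ ‖w‖ ≤ (5 / 4 - θ) * a} ∧
            (Literature.Geometry.DiscreteGeometry.ShellCloseTo (a / 100 + θ) T
              (Finset.image (fun v : EuclideanSpace ℝ (Fin 3) => a • v) Literature.Geometry.DiscreteGeometry.fccKissingPattern) ∨
             Literature.Geometry.DiscreteGeometry.ShellCloseTo (a / 100 + θ) T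
              (Finset.image (fun v : EuclideanSpace ℝ (Fin 3) => a • v) Literature.Geometry.DiscreteGeometry.hcpKissingPattern)))} : ℝ) := by
  intro θ hθ Q hsep t hbad ε hε
  exact exists_blocks
    (G := fun μ : Measure E3 => ∃ a : ℝ, 9 / 10 ≤ a ∧ a ≤ 1 ∧ ∃ T : Finset E3,
      (↑T : Set E3) = {w : E3 | μ {w} ≠ 0 ∧ w ≠ 0 ∧ ‖w‖ ≤ (5 / 4 - θ) * a} ∧
      (ShellCloseTo (a / 100 + θ) T (Finset.image (fun v : E3 => a • v) fccKissingPattern) ∨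
        ShellCloseTo (a / 100 + θ) T (Finset.image (fun v : E3 => a • v) hcpKissingPattern)))
    (fun hμν => looseGood_congr_of_local hθ hμν) Q hsep t hbad hε

end Summit.AtomisticToContinuum.Crystallization.Theorems.PalmUnimodularRigidityMinimiserShells.NecessityBlocks

end
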